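import Literature.AnabelianGeometry.SemiGraphs.NodNonEdgeVerticialIncidenceProofs
import HarnessLib

/-!
# [NodNon] Lemma 1.7 at one-vertex data with `Π_v = Π_G` (the genuine smooth-curve origins)

Hoshi–Mochizuki, *On the combinatorial anabelian geometry of nodally nondegenerate outer representations*,
Hiroshima Math. J. **41** (2011), Lemma 1.7 p. 290 [cite: HoshiMochizukiNodNon2011, Lem 1.7 p.290], typed over
abc-iut-L3's `PSCDatum` as `PSCDatum.EdgeVerticialContainment` / `PSCDatum.EdgeVerticialAbutment`
(`NodNonEdgeVerticialIncidence.lean`; statements, never asserted).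

PROOF-ONLY file (abc-iut-w5-d174 gen 6, row «NODNON-LEM17@PSC»): the ONE-VERTEX carriers whose vertex group is
all of `Π_G` — the shape of every genuine SMOOTH-CURVE datum of the tree (abc-iut-w5-d195's `Ω_scg`,
`PSCSmoothCurveShape.lean`: no nodes, `Π_v = Π`, one vertex) — satisfy both typed clauses trivially
(`edgeVerticialContainment_of_vertGp_eq_top`, `edgeVerticialAbutment_of_forall_eq` of the companion file):
datum level `edgeVerticialContainment_and_abutment_of_vertGp_eq_top`, and origin level
`forall_edgeVerticialContainment_and_abutment_of_vertGp_eq_top` over any origin predicate `Ω` all of whose data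
are of that shape (the `hΩ` form of `PSCSmoothCurveShape.lean`).  A shape instance is consistency evidence for
the typed predicate, not the printed lemma; nothing here takes a side on [IUTchIII] Cor. 3.12.
-/

namespace Literature.AnabelianGeometry.SemiGraphs

namespace PSCDatum

universe u

variable {P : Type u} [Group P] [TopologicalSpace P]

/-- **Both typed clauses of [NodNon] Lemma 1.7 at every one-vertex datum with `Π_v = Π_G`** (the genuine
smooth-curve shape). [cite: HoshiMochizukiNodNon2011, Lem 1.7 p.290] -/
theorem edgeVerticialContainment_and_abutment_of_vertGp_eq_top (G : PSCDatum P) (v₀ : G.graph.V)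
    (hV : ∀ w, w = v₀) (htop : G.vertGp v₀ = ⊤) :
    G.EdgeVerticialContainment ∧ G.EdgeVerticialAbutment :=
  ⟨G.edgeVerticialContainment_of_vertGp_eq_top v₀ hV htop, G.edgeVerticialAbutment_of_forall_eq v₀ hV⟩

/-- **Origin level**: over any origin predicate `Ω` all of whose data are one-vertex data with every vertex
group equal to `Π_G` (the `hΩ` shape of the smooth-curve origins of `PSCSmoothCurveShape.lean`), every
`Ω`-datum satisfies both typed clauses of [NodNon] Lemma 1.7. [cite: HoshiMochizukiNodNon2011, Lem 1.7 p.290] -/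
theorem forall_edgeVerticialContainment_and_abutment_of_vertGp_eq_top (Ω : PSCOrigin.{u})
    (hΩ : ∀ ⦃Q : Type u⦄ [Group Q] [TopologicalSpace Q] (G : PSCDatum Q), Ω.IsOfPSCType G →
      (∀ v, G.vertGp v = ⊤) ∧ ∃ v₀ : G.graph.V, ∀ w, w = v₀) :
    ∀ ⦃Q : Type u⦄ [Group Q] [TopologicalSpace Q] (G : PSCDatum Q), Ω.IsOfPSCType G →
      G.EdgeVerticialContainment ∧ G.EdgeVerticialAbutment := by
  intro Q _ _ G hG
  obtain ⟨hV, v₀, hv⟩ := hΩ G hG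
  exact G.edgeVerticialContainment_and_abutment_of_vertGp_eq_top v₀ hv (hV v₀)

end PSCDatum

end Literature.AnabelianGeometry.SemiGraphs
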